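import Literature.NumberTheory.EllipticCurves.MasserWustholzSurjectivityProofs
import Literature.NumberTheory.EllipticCurves.MasserWustholzSubfieldReductionProofs
import Literature.NumberTheory.EllipticCurves.MasserWustholzTwistBoundProofs
import Literature.NumberTheory.GaloisRepresentations.SerreTorusNormalizerGL2Fp
import Literature.NumberTheory.GaloisRepresentations.CartanNormalizerSignElement
import HarnessLib

/-!
# Masser–Wüstholz 1993, Theorem (b) over `ℚ`, from Mazur's theorem and Gaudron–Rémond's
# isogeny theorem for pairs (the named fact `masserWustholz_surjective_modEll` reduced to the
# named facts `mazur_isogeny_irreducible` and `GaudronRemond2023_torsionHom_ellipticPair`)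

Topic `NumberTheory/EllipticCurves`; theorems only (no definitions, no named facts).  The named
fact `Literature.NumberTheory.EllipticCurves.masserWustholz_surjective_modEll` (D. Masser,
G. Wüstholz, Bull. LMS 25 (1993), Theorem (b) at `k = ℚ`: absolute `c, γ` with `ρ̄_{E,ℓ}` onto
for every non-CM `E/ℚ` and every prime `ℓ > c max(1, h_F(E))^γ`) is proved here **from** two
named facts of the tree, both unproved there: Mazur's theorem (`mazur_isogeny_irreducible`,
B. Mazur, Invent. Math. 44 (1978), Thm. 1) in the role of Lemma 3.1 over `ℚ` (no rational
`ℓ`-isogeny for `ℓ > 163`), and Gaudron–Rémond's bound for torsion-sharing non-isogenous pairs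
(`Literature.NumberTheory.DiophantineGeometry.GaudronRemond2023_torsionHom_ellipticPair`,
Mém. SMF 176 (2023), Thm. 1.5 (1) + 1.8) in the role of Lemma 3.2, through the twisting argument of
Serre 1972 §4.2 c) (`MasserWustholzTwistBoundProofs`) and the group theory of §4 in normaliser
form (`Serre1972.ker_det_le_of_forall_le_normalizer_imp_le`): the exponent obtained is `γ = 4`.

* `exists_resGalOfEmb_eq` — the restriction `Γ_F → Γ_ℚ` along an `F`-linear `ι : ℚ̄ → F̄` is
  onto `Gal(ℚ̄/F)` (for `F ⊂ ℚ̄` finite over the base).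
* `addAut_frame_symm_sign` — the automorphism `Φ⁻¹(M)` of `E[ℓ]` commutes with `σ` when
  `M Φ(ρ̄σ) M⁻¹ = Φ(ρ̄σ)` and anticommutes when `M Φ(ρ̄σ) M⁻¹ = -Φ(ρ̄σ)`.
* `hasSurjectiveModNGaloisRep_of_irreducible_of_twistBound` — **Theorem (b) over `ℚ` for one
  prime** `ℓ > C₁ max(1, h_F(E))⁴`, `C₁ = (241 (4e)⁸ 4⁵ · 60 · 60)⁴`, given irreducibility of
  `E[ℓ]` and the Gaudron–Rémond fact: by the normaliser-form `SL₂`-criterion it suffices to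
  refute a subgroup `U = Gal(ℚ̄/F) ≤ Γ_ℚ` of index `≤ 60` with `ρ̄(U) ⊆ N(C)`, `⊄ C`; over the
  number field `F` (`[F:ℚ] ≤ 60`), with `M ∈ C` from `Serre1972.exists_mem_forall_conj_eq_of_le_normalizer`
  transported to `E_F[ℓ]`, `MasserWustholz1993.prime_le_of_addEquiv_sign` bounds `ℓ`.
* `masserWustholz_surjective_modEll_of_mazur_of_gaudronRemond` — **the named fact from the two
  named facts**, with `c = max(163, C₁)`, `γ = 4`.

## References

* [MasserWustholzBLMS1993] D. Masser, G. Wüstholz, Bull. LMS 25 (1993) 247–254, Theorem, §4.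
* [Mazur1978] B. Mazur, Invent. Math. 44 (1978), Thm. 1.
* [GaudronRemond2023] É. Gaudron, G. Rémond, Mém. SMF 176 (2023), Thm. 1.5 (1), Thm. 1.8.
* [Serre1972] J.-P. Serre, Invent. Math. 15 (1972), §2.2, §2.6, §4.2 c), §5.2 (iii)–(iv).
-/

noncomputable section

open scoped Classical MatrixGroups

namespace Literature.NumberTheory.EllipticCurves.MasserWustholz1993

open _root_.WeierstrassCurve Field IntermediateField _root_.Matrix
  Literature.NumberTheory.GaloisRepresentations Literature.NumberTheory.GaloisRepresentations.Serre1972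
  Literature.NumberTheory.DiophantineGeometry

/-! ### The restriction `Γ_F → Γ_K` along an `F`-linear `ι` is onto `Gal(K̄/F)` -/

/-- For an intermediate field `F` of `K̄/K`, finite over `K`, and a `K`-embedding `ι : K̄ → F̄`
which is `F`-linear on `F ⊂ K̄`, every `σ ∈ Gal(K̄/F)` is the restriction along `ι` of some
`τ ∈ Γ_F` (namely `ι σ ι⁻¹`, `ι` being bijective: `algEquivOfEmb`); cf. the tree's
`galSubgroupClosure_le_range_resGal`. [folklore] -/
theorem exists_resGalOfEmb_eq {K : Type} [Field K] (F : IntermediateField K (AlgebraicClosure K))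
    [FiniteDimensional K F] (ι : AlgebraicClosure K →ₐ[K] AlgebraicClosure F)
    (hι : ∀ x : F, ι (x : AlgebraicClosure K) = algebraMap F (AlgebraicClosure F) x)
    (σ : absoluteGaloisGroup K) (hσ : ∀ x ∈ F, σ • x = x) :
    ∃ τ : absoluteGaloisGroup F, resGalOfEmb ι τ = σ := by
  let e : AlgebraicClosure K ≃ₐ[K] AlgebraicClosure F := algEquivOfEmb F ι
  let σ' : AlgebraicClosure K ≃ₐ[K] AlgebraicClosure K := σ
  let r : AlgebraicClosure F ≃+* AlgebraicClosure F :=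
    (e.symm.toRingEquiv.trans σ'.toRingEquiv).trans e.toRingEquiv
  have hr : ∀ z, r z = e (σ' (e.symm z)) := fun z ↦ rfl
  have he : ∀ z, e z = ι z := fun z ↦ rfl
  have hrF : ∀ x : F, r (algebraMap F (AlgebraicClosure F) x) =
      algebraMap F (AlgebraicClosure F) x := by
    intro x
    rw [hr]
    have h1 : e.symm (algebraMap F (AlgebraicClosure F) x) = (x : AlgebraicClosure K) := by
      rw [AlgEquiv.symm_apply_eq, he]
      exact (hι x).symm
    rw [h1]
    have h2 : σ' (x : AlgebraicClosure K) = x := hσ x x.2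
    rw [h2, he]
    exact hι x
  let τ : AlgebraicClosure F ≃ₐ[F] AlgebraicClosure F := AlgEquiv.ofRingEquiv (f := r) hrF
  refine ⟨τ, ?_⟩
  apply AlgEquiv.ext
  intro z
  apply ι.injective
  change ι ((show AlgebraicClosure K ≃ₐ[K] AlgebraicClosure K from resGalAuxOfEmb ι τ) z) =
    ι (σ' z)
  rw [apply_resGalAuxOfEmb_apply]
  change r (ι z) = ι (σ' z)
  rw [hr]
  have h2 : e.symm (ι z) = z := by
    rw [← he]
    exact e.symm_apply_apply z
  rw [h2]
  rfl

/-- **The fixed field of an open subgroup** (as in `exists_intermediateField_of_isOpen`, with the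
membership criterion in both directions): for `K` perfect and `U ≤ Γ_K` open there is a finite
`F/K` inside `K̄` with `[F : K] = (Γ_K : U)` and `U = Gal(K̄/F)`. [folklore] -/
theorem exists_intermediateField_mem_iff (K : Type) [Field K] [PerfectField K]
    (U : Subgroup (absoluteGaloisGroup K)) (hU : IsOpen (U : Set (absoluteGaloisGroup K))) :
    ∃ F : IntermediateField K (AlgebraicClosure K), FiniteDimensional K F ∧
      Module.finrank K F = U.index ∧
      ∀ σ : absoluteGaloisGroup K, σ ∈ U ↔ ∀ x ∈ F, σ • x = x := by
  haveI : IsGalois K (AlgebraicClosure K) := {}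
  let Uc : ClosedSubgroup (AlgebraicClosure K ≃ₐ[K] AlgebraicClosure K) :=
    ⟨U, U.isClosed_of_isOpen hU⟩
  have hfix : (fixedField (Uc : Subgroup (AlgebraicClosure K ≃ₐ[K] AlgebraicClosure K))).fixingSubgroup
      = U := InfiniteGalois.fixingSubgroup_fixedField Uc
  refine ⟨fixedField (Uc : Subgroup (AlgebraicClosure K ≃ₐ[K] AlgebraicClosure K)),
    by rw [← InfiniteGalois.isOpen_iff_finite, hfix]; exact hU,
    by rw [IntermediateField.finrank_eq_fixingSubgroup_index, hfix]; rfl, fun σ ↦ ⟨fun hσ ↦ ?_, fun hσ ↦ ?_⟩⟩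
  · have hmem : absoluteGaloisGroup.toAlgEquiv K σ ∈ (fixedField
        (Uc : Subgroup (AlgebraicClosure K ≃ₐ[K] AlgebraicClosure K))).fixingSubgroup := by
      rw [hfix]; exact hσ
    exact (IntermediateField.mem_fixingSubgroup_iff _ _).mp hmem
  · have hmem : absoluteGaloisGroup.toAlgEquiv K σ ∈ (fixedField
        (Uc : Subgroup (AlgebraicClosure K ≃ₐ[K] AlgebraicClosure K))).fixingSubgroup :=
      (IntermediateField.mem_fixingSubgroup_iff _ _).mpr hσ
    rw [hfix] at hmem
    exact hmem

/-- **Transport of `E[n]` to `E_F[n]` along the restriction `Γ_F → Gal(K̄/F) ≤ Γ_K`.**  For a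
finite `F/K` inside `K̄` there are a continuous `r : Γ_F → Γ_K`, fixing `F` and onto
`Gal(K̄/F)`, and an additive isomorphism `θ : E[n] ≃+ E_F[n]` with `θ(r(τ) P) = τ θ(P)`: `r` is
the restriction along an `F`-linear `ι : K̄ → F̄` (`exists_algHom_algebraicClosure_extending`,
`resGalOfEmb`, `exists_resGalOfEmb_eq`) and `θ` the map on points along `ι` (`pointsMapOfEmb`,
bijective, then `localPointsEquivGeomPoints`), restricted to `n`-torsion. [folklore] -/
theorem exists_resGal_torsion_transport (K : Type) [Field K] (W : WeierstrassCurve K)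
    (F : IntermediateField K (AlgebraicClosure K)) [FiniteDimensional K F] (n : ℤ) :
    ∃ (r : absoluteGaloisGroup F →ₜ* absoluteGaloisGroup K)
      (θ : geomTorsion W n ≃+ geomTorsion (W.baseChange F) n),
      (∀ τ : absoluteGaloisGroup F, ∀ x ∈ F, r τ • x = x) ∧
      (∀ σ : absoluteGaloisGroup K, (∀ x ∈ F, σ • x = x) → ∃ τ, r τ = σ) ∧
      (∀ (τ : absoluteGaloisGroup F) (P : geomTorsion W n), θ (r τ • P) = τ • θ P) ∧
      ∀ (τ : absoluteGaloisGroup F) (Q : geomTorsion (W.baseChange F) n),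
        θ.symm (τ • Q) = r τ • θ.symm Q := by
  obtain ⟨ι, hι⟩ := exists_algHom_algebraicClosure_extending K F
  set T : geomPoints W →+ geomPoints (W.baseChange F) :=
    (localPointsEquivGeomPoints W F).toAddMonoidHom.comp (pointsMapOfEmb W ι) with hT
  have hTsmul : ∀ (τ : absoluteGaloisGroup F) (P : geomPoints W),
      T (resGalOfEmb ι τ • P) = τ • T P := fun τ P ↦ by
    change localPointsEquivGeomPoints W F (pointsMapOfEmb W ι _) =
      τ • localPointsEquivGeomPoints W F (pointsMapOfEmb W ι P)
    rw [pointsMapOfEmb_smul, localPointsEquivGeomPoints_smul]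
  have hTbij : Function.Bijective T :=
    (localPointsEquivGeomPoints W F).bijective.comp (pointsMapOfEmb_bijective F W ι)
  set θ : geomTorsion W n ≃+ geomTorsion (W.baseChange F) n :=
    torsionByCongr (AddEquiv.ofBijective T hTbij) n with hθdef
  have hθ : ∀ (τ : absoluteGaloisGroup F) (P : geomTorsion W n),
      θ (resGalOfEmb ι τ • P) = τ • θ P := fun τ P ↦ Subtype.ext (hTsmul τ P)
  refine ⟨resGalOfEmb ι, θ, fun τ x hx ↦ ?_, fun σ hσ ↦ exists_resGalOfEmb_eq F ι hι σ hσ, hθ,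
    fun τ Q ↦ ?_⟩
  · refine ι.injective ((apply_resGalAuxOfEmb_apply ι τ x).trans ?_)
    have hx' : ι x = algebraMap F (AlgebraicClosure F) ⟨x, hx⟩ := hι ⟨x, hx⟩
    rw [hx']
    exact (AlgEquiv.commutes (absoluteGaloisGroup.toAlgEquiv F τ) ⟨x, hx⟩).trans hx'.symm
  · apply θ.injective
    rw [AddEquiv.apply_symm_apply, hθ, AddEquiv.apply_symm_apply]

/-! ### The automorphism `Φ⁻¹(M)` of `E[ℓ]` and its commutation sign with `Γ` -/

/-- Given an additive frame `e : E[ℓ] ≃+ 𝔽_ℓ²` and the corresponding `Φ : Aut(E[ℓ]) ≅ GL₂(𝔽_ℓ)`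
(`e (g x) = Φ(g) e(x)`), the automorphism `A = Φ⁻¹(M)` of `E[ℓ]` satisfies `A(σP) = σ A(P)`
when `M Φ(ρ̄σ) M⁻¹ = Φ(ρ̄σ)`, and `A(σP) = -σ A(P)` when `M Φ(ρ̄σ) M⁻¹ = -Φ(ρ̄σ)`.
[folklore] -/
theorem addAut_frame_symm_sign {K : Type} [Field K] (W : WeierstrassCurve K) (ℓ : ℕ)
    [Fact ℓ.Prime] (e : geomTorsion W ℓ ≃+ (Fin 2 → ZMod ℓ))
    (Φ : Multiplicative (AddAut (geomTorsion W ℓ)) ≃* GL (Fin 2) (ZMod ℓ))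
    (he : ∀ (g : Multiplicative (AddAut (geomTorsion W ℓ))) (x : geomTorsion W ℓ),
      e (Multiplicative.toAdd g x) =
        Matrix.mulVec ((Φ g : GL (Fin 2) (ZMod ℓ)) : Matrix (Fin 2) (Fin 2) (ZMod ℓ)) (e x))
    (M : GL (Fin 2) (ZMod ℓ)) (σ : absoluteGaloisGroup K) :
    (M * Φ (galoisRepTorsion W ℓ σ) * M⁻¹ = Φ (galoisRepTorsion W ℓ σ) →
        ∀ P : geomTorsion W ℓ,
          Multiplicative.toAdd (Φ.symm M) (σ • P) = σ • Multiplicative.toAdd (Φ.symm M) P) ∧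
      (M * Φ (galoisRepTorsion W ℓ σ) * M⁻¹ = -Φ (galoisRepTorsion W ℓ σ) →
        ∀ P : geomTorsion W ℓ,
          Multiplicative.toAdd (Φ.symm M) (σ • P) = -(σ • Multiplicative.toAdd (Φ.symm M) P)) := by
  have h₁ : ∀ P : geomTorsion W ℓ, e (Multiplicative.toAdd (Φ.symm M) (σ • P)) =
      Matrix.mulVec ((M * Φ (galoisRepTorsion W ℓ σ) : GL (Fin 2) (ZMod ℓ)) :
        Matrix (Fin 2) (Fin 2) (ZMod ℓ)) (e P) := by
    intro P
    have := he (Φ.symm M * galoisRepTorsion W ℓ σ) P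
    rw [toAdd_mul, AddAut.add_apply, galoisRepTorsion_apply, Φ.map_mul,
      MulEquiv.apply_symm_apply] at this
    exact this
  have h₂ : ∀ P : geomTorsion W ℓ, e (σ • Multiplicative.toAdd (Φ.symm M) P) =
      Matrix.mulVec ((Φ (galoisRepTorsion W ℓ σ) * M : GL (Fin 2) (ZMod ℓ)) :
        Matrix (Fin 2) (Fin 2) (ZMod ℓ)) (e P) := by
    intro P
    have := he (galoisRepTorsion W ℓ σ * Φ.symm M) P
    rw [toAdd_mul, AddAut.add_apply, galoisRepTorsion_apply, Φ.map_mul,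
      MulEquiv.apply_symm_apply] at this
    exact this
  refine ⟨fun hc P ↦ e.injective ?_, fun ha P ↦ e.injective ?_⟩
  · have hc' : M * Φ (galoisRepTorsion W ℓ σ) = Φ (galoisRepTorsion W ℓ σ) * M :=
      mul_inv_eq_iff_eq_mul.mp hc
    rw [h₁, h₂, hc']
  · have ha' : M * Φ (galoisRepTorsion W ℓ σ) = -(Φ (galoisRepTorsion W ℓ σ) * M) := by
      rw [← neg_mul]; exact mul_inv_eq_iff_eq_mul.mp ha
    rw [h₁, map_neg, h₂, ha', Units.val_neg, Matrix.neg_mulVec]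

/-! ### Over a number field: a subgroup with image in `N(C) ∖ C` bounds `ℓ` -/

section NumberField

variable (K : Type) [Field K] [NumberField K] (W : WeierstrassCurve K) [W.IsElliptic]

/-- **The twist bound for a subgroup of `Γ_K` with image in the normaliser of a Cartan subgroup.**
Let `K` be a number field, `E = W` non-CM, `ℓ` an odd prime, `(e, Φ)` a frame of `E[ℓ]`,
`U ≤ Γ_K` a subgroup containing `ker ρ̄_{E,ℓ}` whose image `Φρ̄(U)` lies in the normaliser of a
Cartan subgroup `C` and contains an element outside `C`, and `M ∈ GL₂(𝔽_ℓ)` with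
`M g M⁻¹ = g` for `g ∈ Φρ̄(U) ∩ C`, `M g M⁻¹ = -g` for `g ∈ Φρ̄(U) ∖ C`
(`Serre1972.exists_mem_forall_conj_eq_of_le_normalizer`).  If `[K:ℚ] (Γ_K : U) ≤ B` then
`ℓ ≤ (241 (4e)⁸ 4⁵ B max(1, log B, 2 h_F(E) + 3))⁴`.  Proof: `U` is open; `F = K̄^U` is a number
field with `[F:ℚ] = [K:ℚ](Γ_K : U) ≤ B` (`exists_intermediateField_mem_iff`); along the
transport `θ : E[ℓ] ≃+ E_F[ℓ]` over the restriction `r : Γ_F ↠ Gal(K̄/F) = U`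
(`exists_resGal_torsion_transport`) the automorphism `Φ⁻¹(M)` becomes `Mᵥ ∈ Aut(E_F[ℓ])`,
commuting with `τ ∈ U_F = {τ : Φρ̄(rτ) ∈ C}` (open of index `2`, by `(N : C) = 2`) and
anticommuting with `τ ∉ U_F` (`addAut_frame_symm_sign`); `E_F` is non-CM with
`h_F(E_F) = h_F(E)`; `prime_le_of_addEquiv_sign` over `F` gives the bound with `[F:ℚ]`, which is
increasing in the degree. [cite: Serre1972, §4.2 c)] [cite: GaudronRemond2023, Thm. 1.5 (1) and Thm. 1.8] -/
theorem prime_le_of_forall_mem_normalizer (hGR : GaudronRemond2023_torsionHom_ellipticPair)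
    (hW : ¬ W.HasCM) (ℓ : ℕ) [Fact ℓ.Prime] (hℓ2 : ℓ ≠ 2)
    (e : geomTorsion W ℓ ≃+ (Fin 2 → ZMod ℓ))
    (Φ : Multiplicative (AddAut (geomTorsion W ℓ)) ≃* GL (Fin 2) (ZMod ℓ))
    (he : ∀ (g : Multiplicative (AddAut (geomTorsion W ℓ))) (x : geomTorsion W ℓ),
      e (Multiplicative.toAdd g x) =
        Matrix.mulVec ((Φ g : GL (Fin 2) (ZMod ℓ)) : Matrix (Fin 2) (Fin 2) (ZMod ℓ)) (e x))
    (U : Subgroup (absoluteGaloisGroup K)) (hUker : (galoisRepTorsion W ℓ).ker ≤ U)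
    {C : Subgroup (GL (Fin 2) (ZMod ℓ))} (hC : C ∈ cartanSubgroups (ZMod ℓ))
    (hUN : ∀ σ ∈ U, Φ (galoisRepTorsion W ℓ σ) ∈
      Subgroup.normalizer (C : Set (GL (Fin 2) (ZMod ℓ))))
    {σ₁ : absoluteGaloisGroup K} (hσ₁U : σ₁ ∈ U) (hσ₁C : Φ (galoisRepTorsion W ℓ σ₁) ∉ C)
    (M : GL (Fin 2) (ZMod ℓ))
    (hMid : ∀ σ ∈ U, Φ (galoisRepTorsion W ℓ σ) ∈ C →
      M * Φ (galoisRepTorsion W ℓ σ) * M⁻¹ = Φ (galoisRepTorsion W ℓ σ))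
    (hMneg : ∀ σ ∈ U, Φ (galoisRepTorsion W ℓ σ) ∉ C →
      M * Φ (galoisRepTorsion W ℓ σ) * M⁻¹ = -Φ (galoisRepTorsion W ℓ σ))
    {B : ℕ} (hB : Module.finrank ℚ K * U.index ≤ B) :
    (ℓ : ℝ) ≤ (241 * (4 * Real.exp 1) ^ 8 * 4 ^ 5 * B *
      max 1 (max (Real.log B) (2 * W.stableFaltingsHeight + 3))) ^ 4 := by
  have hℓ : ℓ.Prime := Fact.out
  -- `U` is open; its fixed field `F`, a number field with `[F : K] = (Γ_K : U)`
  have hUo : IsOpen (U : Set (absoluteGaloisGroup K)) :=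
    Subgroup.isOpen_mono hUker
      (isOpen_ker_galoisRepTorsion_holds W (n := (ℓ : ℤ)) (by exact_mod_cast hℓ.ne_zero))
  obtain ⟨F, hFfin, hFrank, hmemU⟩ := exists_intermediateField_mem_iff K U hUo
  haveI := hFfin
  haveI : NumberField F := NumberField.of_module_finite K F
  -- `E_F`, the restriction `r : Γ_F → Γ_K` (onto `U`) and the transport `θ : E[ℓ] ≃+ E_F[ℓ]`
  have hVcm : ¬ (W.baseChange F).HasCM := not_hasCM_baseChange_of_not_hasCM (L := F) hW
  have hVh : (W.baseChange F).stableFaltingsHeight = W.stableFaltingsHeight :=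
    stableFaltingsHeight_map_holds (K := K) (L := F) W
  obtain ⟨r, θ, hrF, hrsurj, hθ, hθ'⟩ := exists_resGal_torsion_transport K W F ℓ
  have hrU : ∀ τ : absoluteGaloisGroup F, r τ ∈ U := fun τ ↦ (hmemU _).mpr (hrF τ)
  obtain ⟨τ₁, hτ₁⟩ : ∃ τ₁ : absoluteGaloisGroup F, r τ₁ = σ₁ := hrsurj σ₁ ((hmemU σ₁).mp hσ₁U)
  -- `A = Φ⁻¹(M)` on `E[ℓ]` and its transport `Mᵥ` to `E_F[ℓ]`
  set A : geomTorsion W ℓ ≃+ geomTorsion W ℓ := Multiplicative.toAdd (Φ.symm M) with hA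
  let Mv := (θ.symm.trans A).trans θ
  have hMv : ∀ Q, Mv Q = θ (A (θ.symm Q)) := fun Q ↦ rfl
  -- `U_F = {τ : Φρ̄(rτ) ∈ C}`, open of index `2`
  set UF : Subgroup (absoluteGaloisGroup F) :=
    ((C.comap Φ.toMonoidHom).comap (galoisRepTorsion W ℓ)).comap r.toMonoidHom with hUF
  have hmemUF : ∀ τ : absoluteGaloisGroup F, τ ∈ UF ↔ Φ (galoisRepTorsion W ℓ (r τ)) ∈ C :=
    fun τ ↦ Iff.rfl
  have hUFo : IsOpen (UF : Set (absoluteGaloisGroup F)) := by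
    have hopen : IsOpen (((C.comap Φ.toMonoidHom).comap (galoisRepTorsion W ℓ) :
        Subgroup (absoluteGaloisGroup K)) : Set (absoluteGaloisGroup K)) := by
      refine Subgroup.isOpen_mono (H₁ := (galoisRepTorsion W ℓ).ker) (fun σ hσ ↦ ?_)
        (isOpen_ker_galoisRepTorsion_holds W (n := (ℓ : ℤ)) (by exact_mod_cast hℓ.ne_zero))
      change Φ (galoisRepTorsion W ℓ σ) ∈ C
      rw [MonoidHom.mem_ker.mp hσ, map_one]
      exact C.one_mem
    exact hopen.preimage (map_continuous r)
  have hUF2 : UF.index = 2 := by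
    set N := Subgroup.normalizer (C : Set (GL (Fin 2) (ZMod ℓ))) with hN
    have h2 : (C.subgroupOf N).index = 2 := relIndex_normalizer_eq_two hC (fun _ ↦ hℓ2)
    have hmemN : ∀ τ : absoluteGaloisGroup F, Φ (galoisRepTorsion W ℓ (r τ)) ∈ N :=
      fun τ ↦ hUN _ (hrU τ)
    refine Subgroup.index_eq_two_iff.mpr ⟨τ₁, fun τ ↦ ?_⟩
    rw [hmemUF, hmemUF, map_mul, map_mul, map_mul]
    set x : N := ⟨Φ (galoisRepTorsion W ℓ (r τ)), hmemN τ⟩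
    set a : N := ⟨Φ (galoisRepTorsion W ℓ (r τ₁)), hmemN τ₁⟩
    have key : (x * a : N).1 ∈ C ↔ ((x : N).1 ∈ C ↔ (a : N).1 ∈ C) := by
      have := Subgroup.mul_mem_iff_of_index_two h2 (a := x) (b := a)
      simpa only [Subgroup.mem_subgroupOf] using this
    change Xor ((x * a : N).1 ∈ C) ((x : N).1 ∈ C)
    rw [key]
    have ha : (a : N).1 ∉ C := by
      change Φ (galoisRepTorsion W ℓ (r τ₁)) ∉ C
      rw [hτ₁]; exact hσ₁C
    by_cases hx : (x : N).1 ∈ C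
    · exact Or.inr ⟨hx, fun h ↦ ha (h.mp hx)⟩
    · exact Or.inl ⟨⟨fun h ↦ absurd h hx, fun h ↦ absurd h ha⟩, hx⟩
  -- the signs of `Mᵥ`
  have hMv₁ : ∀ τ ∈ UF, ∀ Q, Mv (τ • Q) = τ • Mv Q := by
    intro τ hτ Q
    have hg := hMid _ (hrU τ) ((hmemUF τ).mp hτ)
    have hAσ := (addAut_frame_symm_sign W ℓ e Φ he M (r τ)).1 hg
    rw [hMv, hMv, hθ', hAσ, hθ]
  have hMv₂ : ∀ τ ∉ UF, ∀ Q, Mv (τ • Q) = -(τ • Mv Q) := by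
    intro τ hτ Q
    have hg := hMneg _ (hrU τ) (fun h ↦ hτ ((hmemUF τ).mpr h))
    have hAσ := (addAut_frame_symm_sign W ℓ e Φ he M (r τ)).2 hg
    rw [hMv, hMv, hθ', hAσ, map_neg, hθ]
  -- the twist bound over `F`, and monotonicity in the degree `[F:ℚ] = [K:ℚ] (Γ_K : U) ≤ B`
  have hb := prime_le_of_addEquiv_sign F _ hGR hVcm hℓ UF hUFo hUF2 Mv hMv₁ hMv₂
  rw [hVh] at hb
  have hDB : Module.finrank ℚ F ≤ B := by
    rw [← Module.finrank_mul_finrank ℚ K F, hFrank]; exact hB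
  have hD1 : 1 ≤ Module.finrank ℚ F := Module.finrank_pos
  set Aₒ : ℝ := 241 * (4 * Real.exp 1) ^ 8 * 4 ^ 5 with hAₒ
  have hA0 : 0 ≤ Aₒ := by positivity
  have hDB' : (Module.finrank ℚ F : ℝ) ≤ B := by exact_mod_cast hDB
  have hD1' : (1 : ℝ) ≤ Module.finrank ℚ F := by exact_mod_cast hD1
  have hm : max 1 (max (Real.log (Module.finrank ℚ F)) (2 * W.stableFaltingsHeight + 3)) ≤
      max 1 (max (Real.log B) (2 * W.stableFaltingsHeight + 3)) :=
    max_le_max le_rfl (max_le_max (Real.log_le_log (by linarith) hDB') le_rfl)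
  have hm0 : 0 ≤ max 1 (max (Real.log (Module.finrank ℚ F)) (2 * W.stableFaltingsHeight + 3)) :=
    zero_le_one.trans (le_max_left _ _)
  refine hb.trans (pow_le_pow_left₀ (mul_nonneg (mul_nonneg hA0 (by linarith)) hm0) ?_ 4)
  exact mul_le_mul (mul_le_mul_of_nonneg_left hDB' hA0) hm hm0 (mul_nonneg hA0 (by linarith))

end NumberField

/-! ### Theorem (b) over `ℚ` for one prime, from irreducibility and the twist bound -/

section Rat

variable (W : WeierstrassCurve ℚ) [W.IsElliptic]

/-- **Masser–Wüstholz 1993, Theorem (b) at `k = ℚ` for one prime `ℓ`, from Mazur-irreducibility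
and the Gaudron–Rémond pair bound.**  Let `E/ℚ` be non-CM, `ℓ` an odd prime with `E[ℓ]`
irreducible and `ℓ > C₁ max(1, h_F(E))⁴`, `C₁ = (241 (4e)⁸ 4⁵ · 60 · 60)⁴`.  Then `ρ̄_{E,ℓ}` is
onto.  By `Serre1972.ker_det_le_of_forall_le_normalizer_imp_le` (with complex conjugation from
`exists_frame_galoisRepTorsion_rat` and `det = χ̄_ℓ` onto) it suffices to show that no
`U = ρ̄⁻¹(H) ≤ Γ_ℚ` of index `≤ 60` has `Φρ̄(U) ⊆ N(C)`, `⊄ C` for a Cartan subgroup `C`; for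
such `U`, `prime_le_of_forall_mem_normalizer` (with `M ∈ C` from
`Serre1972.exists_mem_forall_conj_eq_of_le_normalizer` and `B = 60`) gives
`ℓ ≤ (241 (4e)⁸ 4⁵ · 60 · max(1, log 60, 2 h_F(E) + 3))⁴ ≤ C₁ max(1, h_F(E))⁴`, a contradiction.
[cite: MasserWustholzBLMS1993, §4 (pp. 250–251)] [cite: Serre1972, §4.2 c)] -/
theorem hasSurjectiveModNGaloisRep_of_irreducible_of_twistBound
    (hGR : GaudronRemond2023_torsionHom_ellipticPair) (hW : ¬ W.HasCM) (ℓ : ℕ) [Fact ℓ.Prime]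
    (hℓ2 : ℓ ≠ 2) (hirr : W.HasIrreducibleModPGaloisRep ℓ)
    (hbig : (241 * (4 * Real.exp 1) ^ 8 * 4 ^ 5 * 60 * 60) ^ 4 *
      (max 1 W.stableFaltingsHeight) ^ 4 < ℓ) :
    W.HasSurjectiveModNGaloisRep ℓ := by
  obtain ⟨e, Φ, he, -, -, -, c, hcc, hcdet⟩ := exists_frame_galoisRepTorsion_rat W ℓ
  set ρ := galoisRepTorsion W ℓ with hρ
  set G : Subgroup (GL (Fin 2) (ZMod ℓ)) := ρ.range.map Φ.toMonoidHom with hG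
  rw [← map_range_galoisRepTorsion_eq_top_iff W ℓ Φ]
  refine eq_top_of_ker_det_le_of_det_surjective ?_ (exists_mem_map_range_det_eq W ℓ Φ e he)
  refine ker_det_le_of_forall_le_normalizer_imp_le G hℓ2
    (fun v hv ↦ not_le_eigenvectorStabilizer_of_hasIrreducibleModPGaloisRep W ℓ Φ e he hirr hv)
    (apply_galoisRepTorsion_mem_map_range W ℓ Φ c) hcc hcdet fun H hH C' hC' hHN ↦ ?_
  by_contra hHC
  -- the corestriction `f : Γ_ℚ → G` of `Φ ∘ ρ̄`, onto `G`, and `U = f⁻¹(H)`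
  let f : absoluteGaloisGroup ℚ →* G :=
    (Φ.toMonoidHom.comp ρ).codRestrict G (fun σ ↦ apply_galoisRepTorsion_mem_map_range W ℓ Φ σ)
  have hf : Function.Surjective f := by
    rintro ⟨g, hg⟩
    obtain ⟨σ, hσ⟩ := (mem_map_range_galoisRepTorsion_iff W ℓ Φ).mp hg
    exact ⟨σ, Subtype.ext hσ⟩
  set U : Subgroup (absoluteGaloisGroup ℚ) := H.comap f with hU
  have hUidx : U.index ≤ 60 := by rw [hU, Subgroup.index_comap_of_surjective H hf]; exact hH
  have hkerU : ρ.ker ≤ U := by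
    intro σ hσ
    rw [hU, Subgroup.mem_comap]
    have : f σ = 1 := Subtype.ext (by
      change Φ (ρ σ) = ((1 : G) : GL (Fin 2) (ZMod ℓ))
      rw [MonoidHom.mem_ker.mp hσ, map_one]; rfl)
    rw [this]
    exact H.one_mem
  have hUmap : ∀ σ ∈ U, Φ (ρ σ) ∈ H.map G.subtype := fun σ hσ ↦ ⟨f σ, hσ, rfl⟩
  -- `M ∈ C'` conjugating `Φρ̄(U)` by the sign `±`
  obtain ⟨M, -, hMid, hMneg⟩ := exists_mem_forall_conj_eq_of_le_normalizer hℓ2 hC' hHN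
  -- some `σ₁ ∈ U` with `Φ(ρ̄ σ₁) ∉ C'`
  obtain ⟨σ₁, hσ₁U, hσ₁C⟩ : ∃ σ₁ ∈ U, Φ (ρ σ₁) ∉ C' := by
    by_contra! hall
    apply hHC
    rintro g ⟨h, hh, rfl⟩
    obtain ⟨σ, rfl⟩ := hf h
    exact hall σ hh
  -- the twist bound with `B = 60`
  have hb := prime_le_of_forall_mem_normalizer ℚ W hGR hW ℓ hℓ2 e Φ he U hkerU hC'
    (fun σ hσ ↦ hHN (hUmap σ hσ)) hσ₁U hσ₁C M
    (fun σ hσ hC ↦ hMid _ (hUmap σ hσ) hC) (fun σ hσ hC ↦ hMneg _ (hUmap σ hσ) hC)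
    (B := 60) (by rw [Module.finrank_self, one_mul]; exact hUidx)
  -- `… ≤ C₁ max(1, h)⁴ < ℓ`
  set B : ℝ := max 1 W.stableFaltingsHeight with hB
  set Aₒ : ℝ := 241 * (4 * Real.exp 1) ^ 8 * 4 ^ 5 with hAₒ
  have hB1 : 1 ≤ B := le_max_left _ _
  have hA0 : 0 ≤ Aₒ := by positivity
  have hm : max 1 (max (Real.log (60 : ℕ)) (2 * W.stableFaltingsHeight + 3)) ≤ 60 * B := by
    refine max_le (by linarith) (max_le ?_ ?_)
    · have := Real.log_le_sub_one_of_pos (by norm_num : (0 : ℝ) < (60 : ℕ))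
      push_cast at this ⊢
      linarith
    · have : W.stableFaltingsHeight ≤ B := le_max_right _ _
      linarith
  have hm0 : 0 ≤ max 1 (max (Real.log (60 : ℕ)) (2 * W.stableFaltingsHeight + 3)) :=
    zero_le_one.trans (le_max_left _ _)
  have hpow : (Aₒ * (60 : ℕ) * max 1 (max (Real.log (60 : ℕ)) (2 * W.stableFaltingsHeight + 3))) ^ 4
      ≤ (Aₒ * 60 * 60) ^ 4 * B ^ 4 := by
    rw [← mul_pow]
    refine pow_le_pow_left₀ (mul_nonneg (mul_nonneg hA0 (by positivity)) hm0) ?_ 4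
    push_cast
    calc Aₒ * 60 * max 1 (max (Real.log 60) (2 * W.stableFaltingsHeight + 3))
        ≤ Aₒ * 60 * (60 * B) := by
          apply mul_le_mul_of_nonneg_left _ (by positivity)
          exact_mod_cast hm
      _ = Aₒ * 60 * 60 * B := by ring
  have : (ℓ : ℝ) < ℓ := (hb.trans hpow).trans_lt hbig
  exact lt_irrefl _ this

/-- **Masser–Wüstholz 1993, Theorem (b) over `ℚ` (the named fact
`masserWustholz_surjective_modEll`) from Mazur's theorem and the Gaudron–Rémond pair bound**:
with `c = max(163, C₁)`, `C₁ = (241 (4e)⁸ 4⁵ · 60 · 60)⁴`, and `γ = 4`, for every non-CM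
`E/ℚ` and every prime `ℓ > c max(1, h_F(E))^γ` the representation `ρ̄_{E,ℓ}` is onto
`GL₂(𝔽_ℓ)`: `ℓ > 163` gives irreducibility of `E[ℓ]` (`mazur_isogeny_irreducible`, in place of
Lemma 3.1 over `ℚ`), and `hasSurjectiveModNGaloisRep_of_irreducible_of_twistBound` does the
rest (Gaudron–Rémond in place of Lemma 3.2).  A discharge of the two hypotheses — both named
facts of the tree — discharges `masserWustholz_surjective_modEll`.
[cite: MasserWustholzBLMS1993, Theorem (b) p. 247 and §4] [cite: Mazur1978, Thm. 1]
[cite: GaudronRemond2023, Thm. 1.5 (1) and Thm. 1.8] -/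
theorem masserWustholz_surjective_modEll_of_mazur_of_gaudronRemond
    (hM : mazur_isogeny_irreducible) (hGR : GaudronRemond2023_torsionHom_ellipticPair) :
    masserWustholz_surjective_modEll := by
  set C₁ : ℝ := (241 * (4 * Real.exp 1) ^ 8 * 4 ^ 5 * 60 * 60) ^ 4 with hC₁
  refine ⟨max 163 C₁, ((4 : ℕ) : ℝ), Nat.cast_nonneg _, fun W _ hW ℓ hℓ hlt ↦ ?_⟩
  haveI : Fact ℓ.Prime := ⟨hℓ⟩
  rw [Real.rpow_natCast] at hlt
  set B : ℝ := max 1 W.stableFaltingsHeight with hB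
  have hB1 : 1 ≤ B := le_max_left _ _
  have hB4 : 1 ≤ B ^ 4 := one_le_pow₀ hB1
  have h163 : (163 : ℝ) < ℓ := by
    have : (163 : ℝ) ≤ max 163 C₁ * B ^ 4 :=
      calc (163 : ℝ) = 163 * 1 := by ring
        _ ≤ max 163 C₁ * B ^ 4 := mul_le_mul (le_max_left _ _) hB4 zero_le_one
            (le_trans (by norm_num) (le_max_left _ _))
    exact this.trans_lt hlt
  have h163' : 163 < ℓ := by exact_mod_cast h163
  have hℓ2 : ℓ ≠ 2 := by omega
  have hirr : W.HasIrreducibleModPGaloisRep ℓ := hM W ℓ hℓ (not_mem_mazurPrimes_of_lt h163')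
  have hbig : C₁ * B ^ 4 < ℓ := by
    have h0 : 0 ≤ B ^ 4 := by positivity
    exact (mul_le_mul_of_nonneg_right (le_max_right _ _) h0).trans_lt hlt
  exact hasSurjectiveModNGaloisRep_of_irreducible_of_twistBound W hGR hW ℓ hℓ2 hirr hbig

end Rat

end Literature.NumberTheory.EllipticCurves.MasserWustholz1993

end
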